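import Mathlib
import Summits.AtomisticToContinuum.Crystallization.Theses.PlanarOrderLadder
import Summits.AtomisticToContinuum.Crystallization.Theorems.PeriodPrecisionLadderExactPeriodFromFine

/-!
# `ExactPlanarFromUniform` — the dictionary of route `PlanarOrderLadder` is a theorem

Route `PlanarOrderLadder` (decomp-a2c lens-3, gen 4) files ONE equivalence, the support item `ExactPlanarFromUniform`:
for the hull of a sequence of finite configurations and uniform constants, independent pairs of two-sided `ε`-periods on
balls of every radius `L` and every precision `ε` (lengths in `[a, b]`, transversal margin `a`) give a Delone hull point
with TWO EXACT linearly independent periods.  Proof: Bolzano–Weierstrass twice for the pairs, local-matching compactness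
(`exists_subseq_forall_eventually_match`, landed with the parent's dictionary in
`Theorems.PeriodPrecisionLadderExactPeriodFromFine`; a route-independent copy was refused as `dedup.landed`, p764532) for the sets, separation makes the limit
translations exact periods, the margin survives the limit as linear independence (§A), and the hull is closed under local
limits.  No ground-state hypothesis.  Blocks A–B below are the route's evidence file verbatim.
-/

noncomputable section

namespace Summit.AtomisticToContinuum.Crystallization.Theorems.PlanarOrderLadderExactPlanarFromUniform

open Summit.AtomisticToContinuum.Crystallization.Theses.PlanarOrderLadder

open Literature.MathematicalPhysics.StatisticalMechanics
open Filter Topology Metric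
open Summit.AtomisticToContinuum.Crystallization.Theorems.PeriodPrecisionLadderExactPeriodFromFine

/-! ## A. Transversal margin ↔ linear independence of a pair of translations -/

/-- A pair `(t₁, t₂)` with `‖t₁‖ ≥ a > 0` and transversal margin `a` (`a ≤ ‖t₂ - s • t₁‖` for every real `s`) is
linearly independent. [folklore] -/
theorem linearIndependent_of_margin {t₁ t₂ : EuclideanSpace ℝ (Fin 3)} {a : ℝ} (ha : 0 < a)
    (h1 : a ≤ ‖t₁‖) (hm : ∀ s : ℝ, a ≤ ‖t₂ - s • t₁‖) : LinearIndependent ℝ ![t₁, t₂] := by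
  refine LinearIndependent.pair_iff.2 fun s t hst => ?_
  by_cases ht : t = 0
  · subst ht
    simp only [zero_smul, add_zero] at hst
    have ht₁ : t₁ ≠ 0 := by
      intro h
      rw [h, norm_zero] at h1
      linarith
    exact ⟨(smul_eq_zero.1 hst).resolve_right ht₁, rfl⟩
  · exfalso
    have h2 : t • t₂ = -(s • t₁) := eq_neg_of_add_eq_zero_right hst
    have h3 : t₂ = (-(s / t)) • t₁ := by
      calc t₂ = t⁻¹ • (t • t₂) := by rw [smul_smul, inv_mul_cancel₀ ht, one_smul]
        _ = t⁻¹ • (-(s • t₁)) := by rw [h2]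
        _ = (-(s / t)) • t₁ := by rw [smul_neg, smul_smul, neg_smul, div_eq_inv_mul]
    have h4 := hm (-(s / t))
    rw [h3, sub_self, norm_zero] at h4
    linarith

/-- A linearly independent pair has a positive transversal margin (the distance from `v 1` to the closed line `ℝ ∙ v 0`).
[folklore] -/
theorem exists_margin_of_linearIndependent {v : Fin 2 → EuclideanSpace ℝ (Fin 3)} (hv : LinearIndependent ℝ v) :
    ∃ m : ℝ, 0 < m ∧ ∀ s : ℝ, m ≤ ‖v 1 - s • v 0‖ := by
  let K : Submodule ℝ (EuclideanSpace ℝ (Fin 3)) := ℝ ∙ (v 0)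
  have hK : IsClosed (K : Set (EuclideanSpace ℝ (Fin 3))) := K.closed_of_finiteDimensional
  have hv1 : v 1 ∉ (K : Set (EuclideanSpace ℝ (Fin 3))) := by
    intro h
    obtain ⟨a, ha⟩ := Submodule.mem_span_singleton.1 h
    have hsum : ∑ i, (![a, -1] : Fin 2 → ℝ) i • v i = 0 := by
      rw [Fin.sum_univ_two]
      simp only [Matrix.cons_val_zero, Matrix.cons_val_one, ha, neg_one_smul, add_neg_cancel]
    have h2 := Fintype.linearIndependent_iff.1 hv ![a, -1] hsum 1
    simp at h2
  refine ⟨Metric.infDist (v 1) (K : Set (EuclideanSpace ℝ (Fin 3))),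
    (hK.notMem_iff_infDist_pos ⟨0, K.zero_mem⟩).1 hv1, fun s => ?_⟩
  have hs : s • v 0 ∈ (K : Set (EuclideanSpace ℝ (Fin 3))) := Submodule.mem_span_singleton.2 ⟨s, rfl⟩
  calc Metric.infDist (v 1) (K : Set (EuclideanSpace ℝ (Fin 3))) ≤ dist (v 1) (s • v 0) :=
        Metric.infDist_le_dist_of_mem hs
    _ = ‖v 1 - s • v 0‖ := dist_eq_norm _ _

/-- Uniform bounds for an independent pair of periods of a `δ₀`-separated set: a common `δ ≤ δ₀` below the length of
`v 0` and below the transversal margin, and a common upper bound `b` of the lengths. -/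
theorem pairBounds_of_linearIndependent {v : Fin 2 → EuclideanSpace ℝ (Fin 3)} (hv : LinearIndependent ℝ v)
    {δ₀ : ℝ} (hδ₀ : 0 < δ₀) :
    ∃ δ b : ℝ, 0 < δ ∧ δ ≤ δ₀ ∧ δ ≤ ‖v 0‖ ∧ ‖v 0‖ ≤ b ∧ ‖v 1‖ ≤ b ∧ ∀ s : ℝ, δ ≤ ‖v 1 - s • v 0‖ := by
  obtain ⟨m, hm, hmar⟩ := exists_margin_of_linearIndependent hv
  have h0 : 0 < ‖v 0‖ := norm_pos_iff.2 (hv.ne_zero 0)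
  exact ⟨min δ₀ (min ‖v 0‖ m), max ‖v 0‖ ‖v 1‖, lt_min hδ₀ (lt_min h0 hm), min_le_left _ _,
    (min_le_right _ _).trans (min_le_left _ _), le_max_left _ _, le_max_right _ _,
    fun s => ((min_le_right _ _).trans (min_le_right _ _)).trans (hmar s)⟩


/-! ## B. THE DICTIONARY IS A THEOREM (`ExactPlanarFromUniform`, the one EQUIV of the node) -/

/-- Core of the dictionary: along a subsequence `ψ` on which the hull points converge locally to a `δ`-separated `Y`
and the translations converge to `t∞`, a translation that is a two-sided `1/(n+1)`-period on `‖p‖ ≤ n` at stage `n`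
becomes an EXACT two-sided period of `Y` (radius escapes, precision vanishes, separation freezes the approximants).
[BaakeGrimm2013 Remark 5.6; folklore] -/
theorem exact_period_of_limit {X : ℕ → Set (EuclideanSpace ℝ (Fin 3))} {t : ℕ → EuclideanSpace ℝ (Fin 3)}
    {δ b : ℝ} (hδ : 0 < δ) (htb : ∀ n, ‖t n‖ ≤ b)
    (hAP : ∀ n, ∀ p ∈ X n, ‖p‖ ≤ (n : ℝ) →
      (∃ q ∈ X n, dist (p + t n) q ≤ 1 / ((n : ℝ) + 1)) ∧ (∃ q ∈ X n, dist (p - t n) q ≤ 1 / ((n : ℝ) + 1)))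
    {ψ : ℕ → ℕ} (hψ : StrictMono ψ) {Y : Set (EuclideanSpace ℝ (Fin 3))}
    (hYsep : ∀ p ∈ Y, ∀ q ∈ Y, p ≠ q → δ ≤ dist p q)
    (hmatch : ∀ R ε : ℝ, 0 < ε → ∀ᶠ k in atTop,
        (∀ s ∈ Y, ‖s‖ ≤ R → ∃ a ∈ X (ψ k), dist a s ≤ ε) ∧
        (∀ a ∈ X (ψ k), ‖a‖ ≤ R → ∃ s ∈ Y, dist a s ≤ ε))
    {tinf : EuclideanSpace ℝ (Fin 3)} (hlim : Tendsto (fun k => t (ψ k)) atTop (𝓝 tinf)) :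
    ∀ y ∈ Y, y + tinf ∈ Y ∧ y - tinf ∈ Y := by
  have hb : 0 ≤ b := (norm_nonneg _).trans (htb 0)
  have hprec : ∀ η : ℝ, 0 < η → ∀ᶠ k in atTop, 1 / (((ψ k : ℕ) : ℝ) + 1) ≤ η := by
    intro η hη
    have h1 : Tendsto (fun k : ℕ => (1 : ℝ) / ((k : ℝ) + 1)) atTop (𝓝 0) :=
      tendsto_one_div_add_atTop_nhds_zero_nat
    have h2 : Tendsto (fun k : ℕ => (1 : ℝ) / (((ψ k : ℕ) : ℝ) + 1)) atTop (𝓝 0) := h1.comp hψ.tendsto_atTop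
    exact h2.eventually (eventually_le_nhds hη)
  have hrad : ∀ M : ℝ, ∀ᶠ k in atTop, M ≤ ((ψ k : ℕ) : ℝ) := by
    intro M
    obtain ⟨m, hm⟩ := exists_nat_ge M
    filter_upwards [eventually_ge_atTop m] with k hk
    have h1 : (m : ℝ) ≤ ((ψ k : ℕ) : ℝ) := by exact_mod_cast hk.trans hψ.le_apply
    exact hm.trans h1
  intro y hy
  have key : ∀ η : ℝ, 0 < η →
      (∃ y' ∈ Y, dist (y + tinf) y' ≤ η) ∧ (∃ y' ∈ Y, dist (y - tinf) y' ≤ η) := by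
    intro η hη
    have e1 := hmatch (‖y‖ + b + η) (η / 4) (by positivity)
    have e2 := hprec (η / 4) (by positivity)
    have e3 : ∀ᶠ k in atTop, dist (t (ψ k)) tinf ≤ η / 4 :=
      (Metric.tendsto_nhds.1 hlim (η / 4) (by positivity)).mono fun k hk => hk.le
    have e4 := hrad (‖y‖ + η)
    obtain ⟨k, hk1, hk2, hk3, hk4⟩ := (e1.and (e2.and (e3.and e4))).exists
    have hyn : ‖y‖ ≤ ‖y‖ + b + η := by linarith
    obtain ⟨p, hp, hpy⟩ := hk1.1 y hy hyn
    have hpn : ‖p‖ ≤ ‖y‖ + η / 4 := by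
      have h1 : ‖p‖ ≤ ‖y‖ + dist p y := by
        have := norm_le_norm_add_norm_sub' p y
        rwa [← dist_eq_norm] at this
      linarith
    have hpk : ‖p‖ ≤ ((ψ k : ℕ) : ℝ) := by linarith
    obtain ⟨⟨q₁, hq₁, hq₁d⟩, ⟨q₂, hq₂, hq₂d⟩⟩ := hAP (ψ k) p hp hpk
    have htk : ‖t (ψ k)‖ ≤ b := htb _
    have hq₁n : ‖q₁‖ ≤ ‖y‖ + b + η := by
      have h1 : ‖q₁‖ ≤ ‖p + t (ψ k)‖ + dist q₁ (p + t (ψ k)) := by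
        have := norm_le_norm_add_norm_sub' q₁ (p + t (ψ k))
        rwa [← dist_eq_norm] at this
      have h2 : ‖p + t (ψ k)‖ ≤ ‖p‖ + ‖t (ψ k)‖ := norm_add_le _ _
      rw [dist_comm] at h1
      have h3 : 1 / (((ψ k : ℕ) : ℝ) + 1) ≤ η / 4 := hk2
      linarith
    have hq₂n : ‖q₂‖ ≤ ‖y‖ + b + η := by
      have h1 : ‖q₂‖ ≤ ‖p - t (ψ k)‖ + dist q₂ (p - t (ψ k)) := by
        have := norm_le_norm_add_norm_sub' q₂ (p - t (ψ k))
        rwa [← dist_eq_norm] at this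
      have h2 : ‖p - t (ψ k)‖ ≤ ‖p‖ + ‖t (ψ k)‖ := norm_sub_le _ _
      rw [dist_comm] at h1
      have h3 : 1 / (((ψ k : ℕ) : ℝ) + 1) ≤ η / 4 := hk2
      linarith
    obtain ⟨y₁, hy₁, hqy₁⟩ := hk1.2 q₁ hq₁ hq₁n
    obtain ⟨y₂, hy₂, hqy₂⟩ := hk1.2 q₂ hq₂ hq₂n
    refine ⟨⟨y₁, hy₁, ?_⟩, ⟨y₂, hy₂, ?_⟩⟩
    · calc dist (y + tinf) y₁
          ≤ dist (y + tinf) (p + t (ψ k)) + dist (p + t (ψ k)) y₁ := dist_triangle _ _ _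
        _ ≤ (dist y p + dist tinf (t (ψ k))) + (dist (p + t (ψ k)) q₁ + dist q₁ y₁) :=
            add_le_add (dist_add_add_le _ _ _ _) (dist_triangle _ _ _)
        _ ≤ (η / 4 + η / 4) + (η / 4 + η / 4) := by
            gcongr
            · rwa [dist_comm] at hpy
            · rwa [dist_comm] at hk3
            · exact hq₁d.trans hk2
        _ = η := by ring
    · calc dist (y - tinf) y₂
          ≤ dist (y - tinf) (p - t (ψ k)) + dist (p - t (ψ k)) y₂ := dist_triangle _ _ _
        _ ≤ (dist y p + dist tinf (t (ψ k))) + (dist (p - t (ψ k)) q₂ + dist q₂ y₂) :=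
            add_le_add (dist_sub_sub_le _ _ _ _) (dist_triangle _ _ _)
        _ ≤ (η / 4 + η / 4) + (η / 4 + η / 4) := by
            gcongr
            · rwa [dist_comm] at hpy
            · rwa [dist_comm] at hk3
            · exact hq₂d.trans hk2
        _ = η := by ring
  -- separation: the approximants are constant below δ/2, hence exact
  obtain ⟨⟨y₁, hy₁, hd₁⟩, ⟨y₂, hy₂, hd₂⟩⟩ := key (δ / 4) (by positivity)
  have hclose₁ : ∀ η : ℝ, 0 < η → dist (y + tinf) y₁ ≤ η := by
    intro η hη
    obtain ⟨⟨y', hy', hd'⟩, -⟩ := key (min η (δ / 4)) (by positivity)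
    by_cases h : y' = y₁
    · rw [← h]
      exact hd'.trans (min_le_left _ _)
    · exfalso
      have h1 := hYsep y' hy' y₁ hy₁ h
      have h2 : dist y' y₁ ≤ dist (y + tinf) y' + dist (y + tinf) y₁ := dist_triangle_left _ _ _
      have h3 := min_le_right η (δ / 4)
      linarith
  have hclose₂ : ∀ η : ℝ, 0 < η → dist (y - tinf) y₂ ≤ η := by
    intro η hη
    obtain ⟨-, ⟨y', hy', hd'⟩⟩ := key (min η (δ / 4)) (by positivity)
    by_cases h : y' = y₂
    · rw [← h]
      exact hd'.trans (min_le_left _ _)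
    · exfalso
      have h1 := hYsep y' hy' y₂ hy₂ h
      have h2 : dist y' y₂ ≤ dist (y - tinf) y' + dist (y - tinf) y₂ := dist_triangle_left _ _ _
      have h3 := min_le_right η (δ / 4)
      linarith
  have he₁ : y + tinf = y₁ := by
    refine dist_le_zero.1 (le_of_forall_pos_le_add fun η hη => ?_)
    rw [zero_add]
    exact hclose₁ η hη
  have he₂ : y - tinf = y₂ := by
    refine dist_le_zero.1 (le_of_forall_pos_le_add fun η hη => ?_)
    rw [zero_add]
    exact hclose₂ η hη
  exact ⟨he₁ ▸ hy₁, he₂ ▸ hy₂⟩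

/-- **`ExactPlanarFromUniform` holds** (the certified EQUIV of the node, direction uniform-local-fine ⇒ exact).
At stage `n` (radius `n`, precision `1/(n+1)`) take the hull point `X_n` and the pair `(t₁ⁿ, t₂ⁿ)`;
Bolzano–Weierstrass twice (`‖tᵢⁿ‖ ≤ b`) and local-matching compactness (block A of
`Theorems.PeriodPrecisionLadderExactPeriodFromFine`) give a common subsequence with `tᵢⁿ → uᵢ` and `X_n → Y` locally;
`exact_period_of_limit` makes `u₁, u₂` EXACT two-sided periods of `Y`; the bounds `a ≤ ‖t₁ⁿ‖` and the transversal margin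
`a ≤ ‖t₂ⁿ - s • t₁ⁿ‖` pass to the limit and give linear independence (`linearIndependent_of_margin`); `Y` is
`(r+1)`-dense and a hull point (the hull is closed under local limits). [BaakeGrimm2013 Remark 5.6, Prop. 5.3; folklore] -/
theorem exactPlanarFromUniform_proof :
    Summit.AtomisticToContinuum.Crystallization.Theses.PlanarOrderLadder.ExactPlanarFromUniform := by
  rintro x ⟨δ, r, a, b, hδ, ha, H⟩
  -- data at stage n: radius n, precision 1/(n+1)
  have H' : ∀ n : ℕ, ∃ (X : Set (EuclideanSpace ℝ (Fin 3))) (t₁ t₂ : EuclideanSpace ℝ (Fin 3)),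
      (∀ p ∈ X, ∀ q ∈ X, p ≠ q → δ ≤ dist p q) ∧
      (∀ c : EuclideanSpace ℝ (Fin 3), ∃ p ∈ X, dist p c ≤ r) ∧
      (∀ R ε' : ℝ, 0 < ε' → ∃ᶠ N in Filter.atTop, ∃ s : EuclideanSpace ℝ (Fin 3),
        (∀ p ∈ X, ‖p‖ ≤ R → ∃ i : Fin N, dist (x N i + s) p ≤ ε') ∧
        (∀ i : Fin N, ‖x N i + s‖ ≤ R → ∃ p ∈ X, dist (x N i + s) p ≤ ε')) ∧
      a ≤ ‖t₁‖ ∧ ‖t₁‖ ≤ b ∧ ‖t₂‖ ≤ b ∧ (∀ s : ℝ, a ≤ ‖t₂ - s • t₁‖) ∧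
      (∀ p ∈ X, ‖p‖ ≤ (n : ℝ) → (∃ q ∈ X, dist (p + t₁) q ≤ 1 / ((n : ℝ) + 1)) ∧
        (∃ q ∈ X, dist (p - t₁) q ≤ 1 / ((n : ℝ) + 1))) ∧
      (∀ p ∈ X, ‖p‖ ≤ (n : ℝ) → (∃ q ∈ X, dist (p + t₂) q ≤ 1 / ((n : ℝ) + 1)) ∧
        (∃ q ∈ X, dist (p - t₂) q ≤ 1 / ((n : ℝ) + 1))) := by
    intro n
    obtain ⟨X, hs, hd, hh, t₁, t₂, h1a, h1b, h2b, hm, hap⟩ := H (n : ℝ) (1 / ((n : ℝ) + 1)) (by positivity)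
    exact ⟨X, t₁, t₂, hs, hd, hh, h1a, h1b, h2b, hm, fun p hp hpn => ⟨(hap p hp hpn).1, (hap p hp hpn).2.1⟩,
      fun p hp hpn => (hap p hp hpn).2.2⟩
  choose X t₁ t₂ hsep hden hhull h1a h1b h2b hmar hAP1 hAP2 using H'
  have hb : 0 ≤ b := (norm_nonneg _).trans (h1b 0)
  -- Bolzano–Weierstrass twice
  obtain ⟨u₁, -, φ₁, hφ₁, hlim₁⟩ := tendsto_subseq_of_bounded
    (Metric.isBounded_closedBall : Bornology.IsBounded (closedBall (0 : EuclideanSpace ℝ (Fin 3)) b))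
    (fun n => mem_closedBall_zero_iff.2 (h1b n))
  obtain ⟨u₂, -, φ₂, hφ₂, hlim₂⟩ := tendsto_subseq_of_bounded
    (Metric.isBounded_closedBall : Bornology.IsBounded (closedBall (0 : EuclideanSpace ℝ (Fin 3)) b))
    (fun n => mem_closedBall_zero_iff.2 (h2b (φ₁ n)))
  -- local-matching compactness for the sets along φ₁ ∘ φ₂
  obtain ⟨φ₃, Y, hφ₃, hYsep, hmatch⟩ :=
    exists_subseq_forall_eventually_match hδ (fun n => X (φ₁ (φ₂ n))) (fun n => hsep (φ₁ (φ₂ n)))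
  have hψ : StrictMono (fun k => φ₁ (φ₂ (φ₃ k))) := (hφ₁.comp hφ₂).comp hφ₃
  have hl₁ : Tendsto (fun k => t₁ (φ₁ (φ₂ (φ₃ k)))) atTop (𝓝 u₁) :=
    (hlim₁.comp hφ₂.tendsto_atTop).comp hφ₃.tendsto_atTop
  have hl₂ : Tendsto (fun k => t₂ (φ₁ (φ₂ (φ₃ k)))) atTop (𝓝 u₂) := hlim₂.comp hφ₃.tendsto_atTop
  have hmatch' : ∀ R ε : ℝ, 0 < ε → ∀ᶠ k in atTop,
      (∀ s ∈ Y, ‖s‖ ≤ R → ∃ a ∈ X (φ₁ (φ₂ (φ₃ k))), dist a s ≤ ε) ∧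
      (∀ a ∈ X (φ₁ (φ₂ (φ₃ k))), ‖a‖ ≤ R → ∃ s ∈ Y, dist a s ≤ ε) := hmatch
  -- exact periods of the limit
  have hper₁ := exact_period_of_limit (ψ := fun k => φ₁ (φ₂ (φ₃ k))) hδ h1b hAP1 hψ hYsep hmatch' hl₁
  have hper₂ := exact_period_of_limit (ψ := fun k => φ₁ (φ₂ (φ₃ k))) hδ h2b hAP2 hψ hYsep hmatch' hl₂
  -- linear independence of the limit pair from the margin
  have hu₁ : a ≤ ‖u₁‖ := ge_of_tendsto hl₁.norm (Eventually.of_forall fun k => h1a _)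
  have hum : ∀ s : ℝ, a ≤ ‖u₂ - s • u₁‖ := fun s =>
    ge_of_tendsto ((hl₂.sub (hl₁.const_smul s)).norm) (Eventually.of_forall fun k => hmar _ s)
  have hLI : LinearIndependent ℝ ![u₁, u₂] := linearIndependent_of_margin ha hu₁ hum
  -- Y is (r+1)-dense
  have hYden : ∀ c : EuclideanSpace ℝ (Fin 3), ∃ p ∈ Y, dist p c ≤ r + 1 := by
    intro c
    obtain ⟨k, hk⟩ := (hmatch' (‖c‖ + r) 1 one_pos).exists
    obtain ⟨p, hp, hpc⟩ := hden (φ₁ (φ₂ (φ₃ k))) c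
    have hpn : ‖p‖ ≤ ‖c‖ + r := by
      have h1 : ‖p‖ ≤ ‖c‖ + dist p c := by
        have := norm_le_norm_add_norm_sub' p c
        rwa [← dist_eq_norm] at this
      linarith
    obtain ⟨s, hs, hps⟩ := hk.2 p hp hpn
    refine ⟨s, hs, ?_⟩
    calc dist s c ≤ dist p s + dist p c := dist_triangle_left _ _ _
      _ ≤ 1 + r := add_le_add hps hpc
      _ = r + 1 := add_comm _ _
  -- Y is a hull point (the hull is closed under local limits)
  have hYhull : ∀ R ε : ℝ, 0 < ε → ∃ᶠ N in Filter.atTop, ∃ s : EuclideanSpace ℝ (Fin 3),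
      (∀ p ∈ Y, ‖p‖ ≤ R → ∃ i : Fin N, dist (x N i + s) p ≤ ε) ∧
      (∀ i : Fin N, ‖x N i + s‖ ≤ R → ∃ p ∈ Y, dist (x N i + s) p ≤ ε) := by
    intro R ε hε
    obtain ⟨k, hk⟩ := (hmatch' (R + ε) (ε / 2) (by positivity)).exists
    refine (hhull (φ₁ (φ₂ (φ₃ k))) (R + ε) (ε / 2) (by positivity)).mono ?_
    rintro N ⟨s, hs1, hs2⟩
    refine ⟨s, fun p hp hpR => ?_, fun i hi => ?_⟩
    · obtain ⟨q, hq, hqp⟩ := hk.1 p hp (by linarith)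
      have hqR : ‖q‖ ≤ R + ε := by
        have h1 : ‖q‖ ≤ ‖p‖ + dist q p := by
          have := norm_le_norm_add_norm_sub' q p
          rwa [← dist_eq_norm] at this
        linarith
      obtain ⟨i, hi⟩ := hs1 q hq hqR
      exact ⟨i, (dist_triangle _ q _).trans (by linarith)⟩
    · obtain ⟨q, hq, hiq⟩ := hs2 i (by linarith)
      have hqR : ‖q‖ ≤ R + ε := by
        have h1 : ‖q‖ ≤ ‖x N i + s‖ + dist q (x N i + s) := by
          have := norm_le_norm_add_norm_sub' q (x N i + s)
          rwa [← dist_eq_norm] at this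
        rw [dist_comm] at h1
        linarith
      obtain ⟨p, hp, hqp⟩ := hk.2 q hq hqR
      exact ⟨p, hp, (dist_triangle _ q _).trans (by linarith)⟩
  -- assemble
  refine ⟨Y, ⟨⟨δ, hδ, hYsep⟩, ⟨r + 1, hYden⟩⟩, ⟨![u₁, u₂], hLI, ?_⟩, hYhull⟩
  intro j p hp
  fin_cases j
  · simpa using hper₁ p hp
  · simpa using hper₂ p hp

end Summit.AtomisticToContinuum.Crystallization.Theorems.PlanarOrderLadderExactPlanarFromUniform

end
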